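import Summits.CriticalPhenomena.PercolationContinuityZ3.Theorems.PercNearOneGluingNoHeavyLowerTailThreePointHubEvents
import Summits.CriticalPhenomena.PercolationContinuityZ3.Theorems.PercNearOneGluingNoHeavyLowerTailThreePointVarianceCutVertex
import Summits.CriticalPhenomena.PercolationContinuityZ3.Theorems.PercNearOneGluingNoHeavyLowerTailThreePointIsoProduct
import HarnessLib

/-!
# The three-point variance row `(3PT)` on every hub graph (`V ∖ {a,b,c}` independent), all weights

Support file for crux `stmt-CriticalPhenomena-4575` (`NoHeavyLowerTail`), seat `prim-l12-p1` gen 19 (`--supports stmt-CriticalPhenomena-4575`).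
Memo `run/shared/lean/prim/prim-l12/FROM-prim-l12-p1-g19-COMB-PLUS.md` §7–§8.

Bond percolation `μ = prodBernoulli w` on a finite vertex type `V`, pairwise distinct terminals `a b c`.  A HUB GRAPH is a weight
function in which every pair of non-terminal vertices has weight `0`; the non-terminals ("hubs") may be joined to each of `a, b, c` and the
terminals to each other, with arbitrary weights — this contains every weighted complete bipartite graph `K_{3,k}`, the family on which all
law-level sharpenings of `(3PT)` considered by the seat were refuted or are tight (memo §3, §7).  THIS FILE proves

  `(3PT)   P(a↔b)·P(a↮b) ≤ P(a↔b, a↮c) + P(a↔c, a↮b) + P(b↔c, a↮b)`   on every hub graph (`threePointVariance_hubGraph`).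

Proof [this work].  Off the null event that some hub–hub pair is open, `a` is isolated from `{b,c}` iff its terminal pairs `ab, ac` are
closed and no hub `h` has `s(a,h)` open together with `s(b,h)` or `s(c,h)` (`ThreePointHubEvents.isoEv_iff`, a closure argument on open walks;
the cylinder events and their product probabilities live in `…ThreePointHubEvents.lean`).  Hence the
four isolation probabilities `Q = P(sep)`, `A = P(c isolated)`, `B = P(b isolated)`, `C = P(a isolated)` are products over the hubs (and the
terminal triangle) of single-hub quantities (`real_isoEv`, `real_sepEv`), each factor satisfies the criterion `(K)` of
`ThreePointIsoProduct` (`star_isoK_*`, `tri_isoK`), `(K)` is product-closed, and `(K) ⟹ 2Q − A ≤ (B+C−Q)²` (`threePoint_of_isoK`), which is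
`(3PT)` because `{a↮b} = {a isolated} ∪ {b isolated}` with intersection `sep` and `P(ab|c) = A − Q`, `P(ac|b) = B − Q`, `P(bc|a) = C − Q`.
-/

namespace Summit.CriticalPhenomena.PercolationContinuityZ3.Theorems.ThreePointHubGraphs

open MeasureTheory Set
open Literature.Probability.Percolation Literature.Probability.LatticeModels
open Summit.CriticalPhenomena.PercolationContinuityZ3.Theorems.ThreePointHubEvents

variable {V : Type*} [Fintype V] [DecidableEq V]

/-! ## Transfer to the connection events -/

section transfer
variable (w : Sym2 V → unitInterval) {a b c : V}

/-- `P(a isolated) = P(isoEv a b c)`. [this work] -/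
theorem real_isoA (hab : a ≠ b) (hac : a ≠ c) (hN : (prodBernoulli w).real (bad a b c) = 0) :
    (prodBernoulli w).real ((openConn a b)ᶜ ∩ (openConn a c)ᶜ) = (prodBernoulli w).real (isoEv a b c) := by
  have e : ((openConn a b)ᶜ ∩ (openConn a c)ᶜ) ∩ (bad a b c)ᶜ = isoEv a b c ∩ (bad a b c)ᶜ := by
    ext ω
    simp only [mem_inter_iff, mem_compl_iff]
    constructor
    · rintro ⟨⟨h1, h2⟩, hn⟩; exact ⟨(isoEv_iff hab hac hn).2 ⟨h1, h2⟩, hn⟩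
    · rintro ⟨h, hn⟩; exact ⟨(isoEv_iff hab hac hn).1 h, hn⟩
  rw [← ThreePointVarianceCutVertex.real_inter_compl_of_null w hN ((openConn a b)ᶜ ∩ (openConn a c)ᶜ), e,
    ThreePointVarianceCutVertex.real_inter_compl_of_null w hN]

/-- `P(b isolated) = P(isoEv b a c)`. [this work] -/
theorem real_isoB (hab : a ≠ b) (hbc : b ≠ c) (hN : (prodBernoulli w).real (bad a b c) = 0) :
    (prodBernoulli w).real ((openConn a b)ᶜ ∩ (openConn b c)ᶜ) = (prodBernoulli w).real (isoEv b a c) := by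
  have e : ((openConn a b)ᶜ ∩ (openConn b c)ᶜ) ∩ (bad a b c)ᶜ = isoEv b a c ∩ (bad a b c)ᶜ := by
    ext ω
    simp only [mem_inter_iff, mem_compl_iff]
    have hn_iff : ω ∈ bad b a c ↔ ω ∈ bad a b c := by rw [bad_swap12]
    constructor
    · rintro ⟨⟨h1, h2⟩, hn⟩
      refine ⟨(isoEv_iff (Ne.symm hab) hbc (fun h => hn (hn_iff.1 h))).2 ⟨fun h => h1 ?_, h2⟩, hn⟩
      exact SimpleGraph.Reachable.symm h
    · rintro ⟨h, hn⟩
      obtain ⟨h1, h2⟩ := (isoEv_iff (Ne.symm hab) hbc (fun h => hn (hn_iff.1 h))).1 h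
      exact ⟨⟨fun h => h1 (SimpleGraph.Reachable.symm h), h2⟩, hn⟩
  rw [← ThreePointVarianceCutVertex.real_inter_compl_of_null w hN ((openConn a b)ᶜ ∩ (openConn b c)ᶜ), e,
    ThreePointVarianceCutVertex.real_inter_compl_of_null w hN]

/-- `P(c isolated) = P(isoEv c a b)`. [this work] -/
theorem real_isoC (hac : a ≠ c) (hbc : b ≠ c) (hN : (prodBernoulli w).real (bad a b c) = 0) :
    (prodBernoulli w).real ((openConn a c)ᶜ ∩ (openConn b c)ᶜ) = (prodBernoulli w).real (isoEv c a b) := by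
  have e : ((openConn a c)ᶜ ∩ (openConn b c)ᶜ) ∩ (bad a b c)ᶜ = isoEv c a b ∩ (bad a b c)ᶜ := by
    ext ω
    simp only [mem_inter_iff, mem_compl_iff]
    have hn_iff : ω ∈ bad c a b ↔ ω ∈ bad a b c := by rw [bad_rot]
    constructor
    · rintro ⟨⟨h1, h2⟩, hn⟩
      refine ⟨(isoEv_iff (Ne.symm hac) (Ne.symm hbc) (fun h => hn (hn_iff.1 h))).2 ⟨fun h => h1 ?_, fun h => h2 ?_⟩, hn⟩
      · exact SimpleGraph.Reachable.symm h
      · exact SimpleGraph.Reachable.symm h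
    · rintro ⟨h, hn⟩
      obtain ⟨h1, h2⟩ := (isoEv_iff (Ne.symm hac) (Ne.symm hbc) (fun h => hn (hn_iff.1 h))).1 h
      exact ⟨⟨fun h => h1 (SimpleGraph.Reachable.symm h), fun h => h2 (SimpleGraph.Reachable.symm h)⟩, hn⟩
  rw [← ThreePointVarianceCutVertex.real_inter_compl_of_null w hN ((openConn a c)ᶜ ∩ (openConn b c)ᶜ), e,
    ThreePointVarianceCutVertex.real_inter_compl_of_null w hN]

/-- `P(sep) = P(isoEv a b c ∩ isoEv b a c)`. [this work] -/
theorem real_sep (hab : a ≠ b) (hac : a ≠ c) (hbc : b ≠ c) (hN : (prodBernoulli w).real (bad a b c) = 0) :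
    (prodBernoulli w).real (((openConn a b)ᶜ ∩ (openConn a c)ᶜ) ∩ ((openConn a b)ᶜ ∩ (openConn b c)ᶜ)) =
      (prodBernoulli w).real (isoEv a b c ∩ isoEv b a c) := by
  have e : (((openConn a b)ᶜ ∩ (openConn a c)ᶜ) ∩ ((openConn a b)ᶜ ∩ (openConn b c)ᶜ)) ∩ (bad a b c)ᶜ =
      (isoEv a b c ∩ isoEv b a c) ∩ (bad a b c)ᶜ := by
    ext ω
    simp only [mem_inter_iff, mem_compl_iff]
    have hn_iff : ω ∈ bad b a c ↔ ω ∈ bad a b c := by rw [bad_swap12]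
    constructor
    · rintro ⟨⟨⟨h1, h2⟩, -, h3⟩, hn⟩
      refine ⟨⟨(isoEv_iff hab hac hn).2 ⟨h1, h2⟩,
        (isoEv_iff (Ne.symm hab) hbc (fun h => hn (hn_iff.1 h))).2 ⟨fun h => h1 (SimpleGraph.Reachable.symm h), h3⟩⟩, hn⟩
    · rintro ⟨⟨hA, hB⟩, hn⟩
      obtain ⟨h1, h2⟩ := (isoEv_iff hab hac hn).1 hA
      obtain ⟨-, h3⟩ := (isoEv_iff (Ne.symm hab) hbc (fun h => hn (hn_iff.1 h))).1 hB
      exact ⟨⟨⟨h1, h2⟩, h1, h3⟩, hn⟩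
  rw [← ThreePointVarianceCutVertex.real_inter_compl_of_null w hN (((openConn a b)ᶜ ∩ (openConn a c)ᶜ) ∩ _), e,
    ThreePointVarianceCutVertex.real_inter_compl_of_null w hN]

end transfer

/-! ## The product formulas -/

section formulas
variable (w : Sym2 V → unitInterval) {a b c : V}

/-- `C = P(a isolated)` as a product. [this work] -/
theorem isoA_eq (hab : a ≠ b) (hac : a ≠ c) (hbc : b ≠ c) (hN : (prodBernoulli w).real (bad a b c) = 0) :
    (prodBernoulli w).real ((openConn a b)ᶜ ∩ (openConn a c)ᶜ) =
      (1 - (w s(a, b) : ℝ)) * (1 - (w s(a, c) : ℝ)) *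
        ∏ h ∈ hubs a b c, (1 - (w s(a, h) : ℝ) * (w s(b, h) + w s(c, h) - (w s(b, h) : ℝ) * w s(c, h))) := by
  rw [real_isoA w hab hac hN, real_isoEv, real_tClosed w hbc]
  congr 1
  exact Finset.prod_congr rfl fun h _ => by rw [real_isoH w hab hac hbc]; ring

/-- `B = P(b isolated)` as a product. [this work] -/
theorem isoB_eq (hab : a ≠ b) (hac : a ≠ c) (hbc : b ≠ c) (hN : (prodBernoulli w).real (bad a b c) = 0) :
    (prodBernoulli w).real ((openConn a b)ᶜ ∩ (openConn b c)ᶜ) =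
      (1 - (w s(a, b) : ℝ)) * (1 - (w s(b, c) : ℝ)) *
        ∏ h ∈ hubs a b c, (1 - (w s(b, h) : ℝ) * (w s(a, h) + w s(c, h) - (w s(a, h) : ℝ) * w s(c, h))) := by
  rw [real_isoB w hab hbc hN, real_isoEv, real_tClosed w hac, hubs_swap12, Sym2.eq_swap (a := b) (b := a)]
  congr 1
  exact Finset.prod_congr rfl fun h _ => by rw [real_isoH w (Ne.symm hab) hbc hac]; ring

/-- `A = P(c isolated)` as a product. [this work] -/
theorem isoC_eq (hab : a ≠ b) (hac : a ≠ c) (hbc : b ≠ c) (hN : (prodBernoulli w).real (bad a b c) = 0) :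
    (prodBernoulli w).real ((openConn a c)ᶜ ∩ (openConn b c)ᶜ) =
      (1 - (w s(a, c) : ℝ)) * (1 - (w s(b, c) : ℝ)) *
        ∏ h ∈ hubs a b c, (1 - (w s(c, h) : ℝ) * (w s(a, h) + w s(b, h) - (w s(a, h) : ℝ) * w s(b, h))) := by
  rw [real_isoC w hac hbc hN, real_isoEv, real_tClosed w hab, hubs_rot, Sym2.eq_swap (a := c) (b := a),
    Sym2.eq_swap (a := c) (b := b)]
  congr 1
  exact Finset.prod_congr rfl fun h _ => by rw [real_isoH w (Ne.symm hac) (Ne.symm hbc) hab]; ring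

/-- `Q = P(sep)` as a product. [this work] -/
theorem sep_eq (hab : a ≠ b) (hac : a ≠ c) (hbc : b ≠ c) (hN : (prodBernoulli w).real (bad a b c) = 0) :
    (prodBernoulli w).real (((openConn a b)ᶜ ∩ (openConn a c)ᶜ) ∩ ((openConn a b)ᶜ ∩ (openConn b c)ᶜ)) =
      (1 - (w s(a, b) : ℝ)) * (1 - (w s(a, c) : ℝ)) * (1 - (w s(b, c) : ℝ)) *
        ∏ h ∈ hubs a b c, (1 - (w s(a, h) : ℝ) * w s(b, h) - (w s(a, h) : ℝ) * w s(c, h) - (w s(b, h) : ℝ) * w s(c, h) +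
          2 * (w s(a, h) : ℝ) * w s(b, h) * w s(c, h)) := by
  rw [real_sep w hab hac hbc hN, real_sepEv, real_tClosed_inter w hab hac hbc]
  congr 1
  exact Finset.prod_congr rfl fun h _ => real_sepH w hab hac hbc

end formulas

/-! ## The theorem -/

/-- The terminal-triangle factor satisfies `(K)`: `(pqr)³ ≤ (qr)²(pr)(pq)` for `p, q, r ∈ [0,1]` (it is `p³ ≤ p²`). [this work] -/
theorem tri_isoK {p q r : ℝ} (hp1 : p ≤ 1) (hq : 0 ≤ q) (hr : 0 ≤ r) :
    (p * q * r) ^ 3 ≤ (q * r) ^ 2 * (p * r) * (p * q) := by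
  have h : (q * r) ^ 2 * (p * r) * (p * q) - (p * q * r) ^ 3 = p ^ 2 * (1 - p) * (q ^ 3 * r ^ 3) := by ring
  nlinarith [mul_nonneg (mul_nonneg (sq_nonneg p) (sub_nonneg.2 hp1)) (mul_nonneg (pow_nonneg hq 3) (pow_nonneg hr 3))]

/-- **The three-point variance row on every hub graph, all weights.**  If every pair of vertices outside `{a, b, c}` has weight `0`
(the hubs may be joined to each terminal and the terminals to each other, arbitrarily), then
`P(a↔b)·P(a↮b) ≤ P(a↔b, a↮c) + P(a↔c, a↮b) + P(b↔c, a↮b)`. [this work] -/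
theorem threePointVariance_hubGraph (w : Sym2 V → unitInterval) {a b c : V} (hab : a ≠ b) (hac : a ≠ c) (hbc : b ≠ c)
    (hw : ∀ u v : V, u ≠ a → u ≠ b → u ≠ c → v ≠ a → v ≠ b → v ≠ c → u ≠ v → (w s(u, v) : ℝ) = 0) :
    (prodBernoulli w).real (openConn a b) * (prodBernoulli w).real (openConn a b)ᶜ ≤
      (prodBernoulli w).real (openConn a b ∩ (openConn a c)ᶜ) + (prodBernoulli w).real (openConn a c ∩ (openConn a b)ᶜ) +
        (prodBernoulli w).real (openConn b c ∩ (openConn a b)ᶜ) := by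
  have hN : (prodBernoulli w).real (bad a b c) = 0 := real_bad w fun u hu v hv huv => by
    obtain ⟨hua, hub, huc⟩ := mem_hubs.1 hu
    obtain ⟨hva, hvb, hvc⟩ := mem_hubs.1 hv
    exact hw u v hua hub huc hva hvb hvc huv
  set μ := prodBernoulli w with hμ
  -- the isolation events
  set IA : Set (BondConfig V) := (openConn a b)ᶜ ∩ (openConn a c)ᶜ with hIA
  set IB : Set (BondConfig V) := (openConn a b)ᶜ ∩ (openConn b c)ᶜ with hIB
  set IC : Set (BondConfig V) := (openConn a c)ᶜ ∩ (openConn b c)ᶜ with hIC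
  -- set identities
  have hU : (openConn a b)ᶜ = IA ∪ IB := by
    ext ω
    simp only [hIA, hIB, mem_union, mem_inter_iff, mem_compl_iff]
    constructor
    · intro h
      by_cases hac' : ω ∈ openConn a c
      · exact Or.inr ⟨h, fun hbc' => h (SimpleGraph.Reachable.trans hac' (SimpleGraph.Reachable.symm hbc'))⟩
      · exact Or.inl ⟨h, hac'⟩
    · rintro (⟨h, -⟩ | ⟨h, -⟩) <;> exact h
  have hCsub : IC ⊆ (openConn a b ∩ (openConn a c)ᶜ) ∪ (IA ∩ IB) := by
    intro ω hω
    obtain ⟨h1, h2⟩ := hω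
    by_cases hab' : ω ∈ openConn a b
    · exact Or.inl ⟨hab', h1⟩
    · exact Or.inr ⟨⟨hab', h1⟩, hab', h2⟩
  have hBsub : IB ⊆ (openConn a c ∩ (openConn a b)ᶜ) ∪ (IA ∩ IB) := by
    intro ω hω
    obtain ⟨h1, h2⟩ := hω
    by_cases hac' : ω ∈ openConn a c
    · exact Or.inl ⟨hac', h1⟩
    · exact Or.inr ⟨⟨h1, hac'⟩, h1, h2⟩
  have hAsub : IA ⊆ (openConn b c ∩ (openConn a b)ᶜ) ∪ (IA ∩ IB) := by
    intro ω hω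
    obtain ⟨h1, h2⟩ := hω
    by_cases hbc' : ω ∈ openConn b c
    · exact Or.inl ⟨hbc', h1⟩
    · exact Or.inr ⟨⟨h1, h2⟩, h1, hbc'⟩
  -- probabilities of the cells in terms of `Q, A, B, C`
  have hθc : μ.real (openConn a b)ᶜ = μ.real IA + μ.real IB - μ.real (IA ∩ IB) := by
    have h := measureReal_union_add_inter (μ := μ) (s := IA) (t := IB) MeasurableSet.of_discrete
    rw [hU]; linarith
  have hθ : μ.real (openConn a b) = 1 - μ.real (openConn a b)ᶜ := by
    have h := probReal_compl_eq_one_sub (μ := μ) (s := openConn a b) MeasurableSet.of_discrete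
    linarith
  have hs : μ.real IC - μ.real (IA ∩ IB) ≤ μ.real (openConn a b ∩ (openConn a c)ᶜ) := by
    have h := (measureReal_mono (μ := μ) hCsub).trans (measureReal_union_le _ _)
    linarith
  have ht : μ.real IB - μ.real (IA ∩ IB) ≤ μ.real (openConn a c ∩ (openConn a b)ᶜ) := by
    have h := (measureReal_mono (μ := μ) hBsub).trans (measureReal_union_le _ _)
    linarith
  have hu : μ.real IA - μ.real (IA ∩ IB) ≤ μ.real (openConn b c ∩ (openConn a b)ᶜ) := by
    have h := (measureReal_mono (μ := μ) hAsub).trans (measureReal_union_le _ _)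
    linarith
  -- the criterion `(K)` for `Q = P(IA ∩ IB)`, `A = P(IC)`, `B = P(IB)`, `C = P(IA)`
  have hK : 2 * μ.real (IA ∩ IB) - μ.real IC ≤ (μ.real IB + μ.real IA - μ.real (IA ∩ IB)) ^ 2 := by
    -- weights
    set α : V → ℝ := fun h => (w s(a, h) : ℝ) with hα
    set β : V → ℝ := fun h => (w s(b, h) : ℝ) with hβ
    set γ : V → ℝ := fun h => (w s(c, h) : ℝ) with hγ
    have h01 : ∀ h : V, 0 ≤ α h ∧ α h ≤ 1 ∧ 0 ≤ β h ∧ β h ≤ 1 ∧ 0 ≤ γ h ∧ γ h ≤ 1 := fun h =>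
      ⟨unitInterval.nonneg _, unitInterval.le_one _, unitInterval.nonneg _, unitInterval.le_one _, unitInterval.nonneg _,
        unitInterval.le_one _⟩
    set pab : ℝ := (w s(a, b) : ℝ)
    set pac : ℝ := (w s(a, c) : ℝ)
    set pbc : ℝ := (w s(b, c) : ℝ)
    have hpab : 0 ≤ 1 - pab := sub_nonneg.2 (unitInterval.le_one _)
    have hpac : 0 ≤ 1 - pac := sub_nonneg.2 (unitInterval.le_one _)
    have hpbc : 0 ≤ 1 - pbc := sub_nonneg.2 (unitInterval.le_one _)
    have hpab1 : 1 - pab ≤ 1 := sub_le_self _ (unitInterval.nonneg _)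
    have hpac1 : 1 - pac ≤ 1 := sub_le_self _ (unitInterval.nonneg _)
    have hpbc1 : 1 - pbc ≤ 1 := sub_le_self _ (unitInterval.nonneg _)
    -- hub products
    set PQ : ℝ := ∏ h ∈ hubs a b c, (1 - α h * β h - α h * γ h - β h * γ h + 2 * α h * β h * γ h) with hPQ
    set PA : ℝ := ∏ h ∈ hubs a b c, (1 - γ h * (α h + β h - α h * β h)) with hPA
    set PB : ℝ := ∏ h ∈ hubs a b c, (1 - β h * (α h + γ h - α h * γ h)) with hPB
    set PC : ℝ := ∏ h ∈ hubs a b c, (1 - α h * (β h + γ h - β h * γ h)) with hPC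
    have eQ : μ.real (IA ∩ IB) = (1 - pab) * (1 - pac) * (1 - pbc) * PQ := by
      rw [hIA, hIB, hμ, sep_eq w hab hac hbc hN]
    have eA : μ.real IC = (1 - pac) * (1 - pbc) * PA := by
      rw [hIC, hμ, isoC_eq w hab hac hbc hN]
    have eB : μ.real IB = (1 - pab) * (1 - pbc) * PB := by
      rw [hIB, hμ, isoB_eq w hab hac hbc hN]
    have eC : μ.real IA = (1 - pab) * (1 - pac) * PC := by
      rw [hIA, hμ, isoA_eq w hab hac hbc hN]
    have hQnn : ∀ h ∈ hubs a b c, 0 ≤ 1 - α h * β h - α h * γ h - β h * γ h + 2 * α h * β h * γ h := fun h _ => by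
      obtain ⟨h1, h2, h3, h4, h5, h6⟩ := h01 h; exact ThreePointIsoProduct.star_Q_nonneg h1 h2 h3 h4 h5 h6
    have hPQnn : 0 ≤ PQ := Finset.prod_nonneg hQnn
    have hKA : PQ ^ 3 ≤ PA ^ 2 * PB * PC :=
      ThreePointIsoProduct.isoK_prod (hubs a b c) (fun h => 1 - α h * β h - α h * γ h - β h * γ h + 2 * α h * β h * γ h)
        (fun h => 1 - γ h * (α h + β h - α h * β h)) (fun h => 1 - β h * (α h + γ h - α h * γ h))
        (fun h => 1 - α h * (β h + γ h - β h * γ h)) hQnn fun h _ => by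
      obtain ⟨h1, h2, h3, h4, h5, h6⟩ := h01 h; exact ThreePointIsoProduct.star_isoK_A h1 h2 h3 h4 h5 h6
    have hKB : PQ ^ 3 ≤ PB ^ 2 * PA * PC :=
      ThreePointIsoProduct.isoK_prod (hubs a b c) (fun h => 1 - α h * β h - α h * γ h - β h * γ h + 2 * α h * β h * γ h)
        (fun h => 1 - β h * (α h + γ h - α h * γ h)) (fun h => 1 - γ h * (α h + β h - α h * β h))
        (fun h => 1 - α h * (β h + γ h - β h * γ h)) hQnn fun h _ => by
      obtain ⟨h1, h2, h3, h4, h5, h6⟩ := h01 h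
      exact (ThreePointIsoProduct.star_isoK_B h1 h2 h3 h4 h5 h6).trans_eq (by ring)
    have hKC : PQ ^ 3 ≤ PC ^ 2 * PA * PB :=
      ThreePointIsoProduct.isoK_prod (hubs a b c) (fun h => 1 - α h * β h - α h * γ h - β h * γ h + 2 * α h * β h * γ h)
        (fun h => 1 - α h * (β h + γ h - β h * γ h)) (fun h => 1 - γ h * (α h + β h - α h * β h))
        (fun h => 1 - β h * (α h + γ h - α h * γ h)) hQnn fun h _ => by
      obtain ⟨h1, h2, h3, h4, h5, h6⟩ := h01 h
      exact (ThreePointIsoProduct.star_isoK_C h1 h2 h3 h4 h5 h6).trans_eq (by ring)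
    -- terminal factor
    have hTA := tri_isoK (q := 1 - pac) (r := 1 - pbc) hpab1 hpac hpbc
    have hTB := tri_isoK (q := 1 - pab) (r := 1 - pbc) hpac1 hpab hpbc
    have hTC := tri_isoK (q := 1 - pab) (r := 1 - pac) hpbc1 hpab hpac
    refine ThreePointIsoProduct.threePoint_of_isoK measureReal_nonneg ?_ ?_ ?_ ?_ ?_ ?_
    · exact measureReal_mono fun ω ⟨⟨_, h2⟩, _, h3⟩ => ⟨h2, h3⟩
    · exact measureReal_mono fun ω ⟨_, h⟩ => h
    · exact measureReal_mono fun ω ⟨h, _⟩ => h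
    · rw [eQ, eA, eB, eC]
      calc ((1 - pab) * (1 - pac) * (1 - pbc) * PQ) ^ 3 = ((1 - pab) * (1 - pac) * (1 - pbc)) ^ 3 * PQ ^ 3 := by ring
        _ ≤ ((1 - pac) * (1 - pbc)) ^ 2 * ((1 - pab) * (1 - pbc)) * ((1 - pab) * (1 - pac)) * (PA ^ 2 * PB * PC) :=
            mul_le_mul hTA hKA (pow_nonneg hPQnn 3) (mul_nonneg (mul_nonneg (sq_nonneg _) (mul_nonneg hpab hpbc)) (mul_nonneg hpab hpac))
        _ = _ := by ring
    · rw [eQ, eA, eB, eC]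
      calc ((1 - pab) * (1 - pac) * (1 - pbc) * PQ) ^ 3 = ((1 - pac) * (1 - pab) * (1 - pbc)) ^ 3 * PQ ^ 3 := by ring
        _ ≤ ((1 - pab) * (1 - pbc)) ^ 2 * ((1 - pac) * (1 - pbc)) * ((1 - pac) * (1 - pab)) * (PB ^ 2 * PA * PC) :=
            mul_le_mul hTB hKB (pow_nonneg hPQnn 3) (mul_nonneg (mul_nonneg (sq_nonneg _) (mul_nonneg hpac hpbc)) (mul_nonneg hpac hpab))
        _ = _ := by ring
    · rw [eQ, eA, eB, eC]
      calc ((1 - pab) * (1 - pac) * (1 - pbc) * PQ) ^ 3 = ((1 - pbc) * (1 - pab) * (1 - pac)) ^ 3 * PQ ^ 3 := by ring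
        _ ≤ ((1 - pab) * (1 - pac)) ^ 2 * ((1 - pbc) * (1 - pac)) * ((1 - pbc) * (1 - pab)) * (PC ^ 2 * PA * PB) :=
            mul_le_mul hTC hKC (pow_nonneg hPQnn 3) (mul_nonneg (mul_nonneg (sq_nonneg _) (mul_nonneg hpbc hpac)) (mul_nonneg hpbc hpab))
        _ = _ := by ring
  -- conclusion
  have h0 : 0 ≤ μ.real (openConn a b ∩ (openConn a c)ᶜ) := measureReal_nonneg
  rw [hθ, hθc]
  nlinarith [hK, hs, ht, hu]

end Summit.CriticalPhenomena.PercolationContinuityZ3.Theorems.ThreePointHubGraphs
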